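import Summits.CriticalPhenomena.PercolationContinuityZ3.Theorems.PercNearOneGluingNoHeavyLowerTailSahiGridPatternPairCert
import Summits.CriticalPhenomena.PercolationContinuityZ3.Theorems.PercNearOneGluingNoHeavyLowerTailSahiGridPatternDiagCert
import Summits.CriticalPhenomena.PercolationContinuityZ3.Theorems.PercNearOneGluingNoHeavyLowerTailSahiGridPatternKleitman

/-!
# `NoHeavyLowerTail` (crux stmt-CriticalPhenomena-4575), Sahi programme P1: **SOUNDNESS OF S-BLOCK ROUTING FOR THE BLOCK-AND CERTIFICATE STEP** —
# a rectangle-dominated weight `μ` on pairs of S-block points plus the routing inequality `Θ_{S×V}(P×Q) ≤ Σ μ(ξ,η)·Θ_V(P^ξ×Q^η)` give condition (N) for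
# `d' = 2^n·1_S ⊗ d` on `S × V`; with (T) (file `…DiagCertBlockAndT`) the block product is a good first slot in every dimension

Support file (Sahi cell, seat `prim-sahi-p1`, generation 29; `--supports stmt-CriticalPhenomena-4575`).  Pure proofs, no definitions, no `sorry`,
standard axioms.  Vocabulary of `…SahiGridPattern{,CellForm,SliceForm,DiagCert,PairCert,Kleitman}` (`Pd`, `glue`, `freeOf`, `cellOf`, `fibre`, `sect`, `ind`,
`thetaVal`, `lamU`, `cylSet`, `sStarD`).  The generation-29 companions `…DiagCertBlockAndT` / `…DiagCertBlockAndTheta` are not imported (not yet built on the farm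
when this file was checked); their results enter as the hypotheses `hT'` / `hR` below.

THE MATHEMATICS.  `S ⊆ [3]^n`, `V ⊆ [3]^k` up-sets, `A = S × V` (`glue ξ z ∈ A ↔ ξ ∈ S ∧ z ∈ V`), `d ≥ 0` a diagonal certificate of `V` (conditions (T), (N) of
`…SahiGridPatternDiagCert`), `d'(x) = 2^n·1_S(freeOf x)·d(cellOf x)`.  A ROUTING WEIGHT for `S` is `μ : [3]^n × [3]^n → ℤ`, `μ ≥ 0`, RECTANGLE-DOMINATED by
`diag(2^n·1_S)`:
   (H)  `Σ_{ξ,η} μ(ξ,η)·1_X(ξ)1_{X'}(η) ≤ 2^n·Σ_ξ 1_S(ξ)1_X(ξ)1_{X'}(ξ)`  for all up-sets `X, X' ⊆ [3]^n`,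
and the ROUTING INEQUALITY for `(S, μ, V)` is
   (R)  `Θ_A(P×Q) ≤ Σ_{ξ,η} μ(ξ,η)·Θ_V(P^ξ × Q^η)`  for all up-sets `P, Q ⊆ [3]^{n+k}`  (`P^ξ` the sections).
**THEOREM (`diagCert_blockAnd_N_of_routing`, every `n, k`).**  (H) + (R) + (N) for `(V,d)` + `d ≥ 0` ⟹ (N) for `(A, d')`:
   `Θ_A(P×Q) ≤ Σ_{x ∈ P∩Q} d'(x)`.
PROOF (three lines): `Σ_{x∈P∩Q} d'(x) = Σ_q d(q)·2^nΣ_ξ 1_S1_{P_q}1_{Q_q}(ξ) ≥ Σ_q d(q)·Σ_{ξ,η}μ(ξ,η)1_{P_q}(ξ)1_{Q_q}(η)` ((H) on the fibres `P_q, Q_q`, up-sets, `d ≥ 0`)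
`= Σ_{ξ,η} μ(ξ,η)·d(P^ξ∩Q^η) ≥ Σ_{ξ,η} μ(ξ,η)·Θ_V(P^ξ×Q^η)` ((N) on the sections, `μ ≥ 0`) `≥ Θ_A(P×Q)` ((R)).
**COROLLARY (`sStarD_blockAnd_cylSet_nonneg_of_routing`).**  If moreover `d'` satisfies (T) for `A` (hypothesis `hT'`; this is `…DiagCertBlockAndT.diagCert_blockAnd_T`,
valid for EVERY up-set `S`), then `[3]^m × (S×V)` is a good first slot of the pattern functional for every `m` (`sStarD_cylSet_nonneg_of_diagCert`).
WHERE (R) COMES FROM.  `…DiagCertBlockAndTheta.theta_blockAnd_le` gives `Θ_A(P×Q) ≤ Σ_{ξ,η} Θ_S(ξ,η)Θ_V(P^ξ×Q^η)` for all up-sets; hence (R) holds with `μ = Θ_S⁺`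
whenever `Θ_V ≥ 0` on section pairs (`theta_bilin_nonneg`), and (H) for `Θ_S⁺` holds exactly for `⊤` and the cylinders `{x_i ≥ 1}` (computation, `j ≤ 3`).  For the
other Θ-Harris `S` (those with (N) for the trivial vector `2^n·1_S`: e.g. all orthants and `↑{12,21} ⊆ [3]²`) the seat's LP (memo FROM-prim-sahi-p1-gen29 §3) produces
`μ` with (H) and a finite ROUTING CERTIFICATE deriving (R) from `theta_blockAnd_le`-type Kleitman atoms and the nestedness of sections — exact rational certificates for all
13 Θ-Harris `S ⊆ [3]^j`, `j ≤ 2`, and 29 of the 57 in `[3]³` (the rest LP-feasible); those per-`S` derivations of (R) are not formalised here.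
Nothing in this file asserts `PatternPos d` for `d ≥ 4`, nor (H)/(R) for any particular `S`. [this work]
-/

namespace Summit.CriticalPhenomena.PercolationContinuityZ3.Theorems.SahiGridPattern

open Finset SahiGrid3
open scoped BigOperators

variable {n k : ℕ} {S : Finset (Pd n)} {V : Finset (Pd k)} {A : Finset (Pd (n + k))}

/-- `d(P^ξ ∩ Q^η)` as an indicator sum over cells. [this work] -/
theorem sum_mem_sect_inter_eq (d : Pd k → ℤ) (P Q : Finset (Pd (n + k))) (ξ η : Pd n) :
    (∑ q ∈ sect P ξ ∩ sect Q η, d q) = ∑ q : Pd k, ind P (glue ξ q) * ind Q (glue η q) * d q := by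
  rw [sum_mem_eq_sum_ind_mul (sect P ξ ∩ sect Q η) d]
  refine Finset.sum_congr rfl fun q _ => ?_
  rw [ind_inter_eq_mul, ind_sect, ind_sect]

/-- `d'(P ∩ Q)` by cells: `Σ_{x∈P∩Q} 2^n·1_S(freeOf x)·d(cellOf x) = Σ_q d(q)·2^n·Σ_ξ 1_S(ξ)1_P(glue ξ q)1_Q(glue ξ q)`. [this work] -/
theorem sum_mem_inter_dprime_eq (d : Pd k → ℤ) (P Q : Finset (Pd (n + k))) :
    (∑ x ∈ P ∩ Q, (2:ℤ) ^ n * ind S (freeOf x) * d (cellOf x)) =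
      ∑ q : Pd k, d q * ((2:ℤ) ^ n * ∑ ξ : Pd n, ind S ξ * ind P (glue ξ q) * ind Q (glue ξ q)) := by
  rw [sum_mem_eq_sum_ind_mul (P ∩ Q), sum_glue, Finset.sum_comm]
  refine Finset.sum_congr rfl fun q _ => ?_
  rw [Finset.mul_sum, Finset.mul_sum]
  refine Finset.sum_congr rfl fun ξ _ => ?_
  rw [ind_inter_eq_mul, freeOf_glue, cellOf_glue]
  ring

/-- **THEOREM (soundness of S-block routing; every `n, k`).**  Let `S ⊆ [3]^n` (any finset), `V ⊆ [3]^k`, `A = S × V`, `d ≥ 0` with (N) for `(V, d)`, and let `μ ≥ 0`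
satisfy (H) (rectangle domination by `diag(2^n·1_S)` on up-set pairs) and the routing inequality (R).  Then `d' = 2^n·1_S ⊗ d` satisfies (N) for `A`. [this work] -/
theorem diagCert_blockAnd_N_of_routing (hA : ∀ ξ z, glue ξ z ∈ A ↔ (ξ ∈ S ∧ z ∈ V)) (d : Pd k → ℤ) (hd : ∀ q, 0 ≤ d q)
    (hN : ∀ X X' : Finset (Pd k), IsUpperSet (X : Set (Pd k)) → IsUpperSet (X' : Set (Pd k)) →
      (∑ q ∈ X, ∑ r ∈ X', thetaVal V q r) ≤ ∑ q ∈ X ∩ X', d q)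
    (μ : Pd n → Pd n → ℤ) (hμ : ∀ ξ η, 0 ≤ μ ξ η)
    (hH : ∀ X X' : Finset (Pd n), IsUpperSet (X : Set (Pd n)) → IsUpperSet (X' : Set (Pd n)) →
      (∑ ξ : Pd n, ∑ η : Pd n, μ ξ η * (ind X ξ * ind X' η)) ≤ (2:ℤ) ^ n * ∑ ξ : Pd n, ind S ξ * ind X ξ * ind X' ξ)
    (hR : ∀ P Q : Finset (Pd (n + k)), IsUpperSet (P : Set (Pd (n + k))) → IsUpperSet (Q : Set (Pd (n + k))) →
      (∑ x ∈ P, ∑ y ∈ Q, thetaVal A x y) ≤ ∑ ξ : Pd n, ∑ η : Pd n, μ ξ η * ∑ q ∈ sect P ξ, ∑ r ∈ sect Q η, thetaVal V q r)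
    {P Q : Finset (Pd (n + k))} (hP : IsUpperSet (P : Set (Pd (n + k)))) (hQ : IsUpperSet (Q : Set (Pd (n + k)))) :
    (∑ x ∈ P, ∑ y ∈ Q, thetaVal A x y) ≤ ∑ x ∈ P ∩ Q, (2:ℤ) ^ n * ind S (freeOf x) * d (cellOf x) := by
  have _ := hA
  -- step 3: (R)
  refine le_trans (hR P Q hP hQ) ?_
  -- step 2: (N) on the section pairs, weighted by μ ≥ 0
  have h2 : (∑ ξ : Pd n, ∑ η : Pd n, μ ξ η * ∑ q ∈ sect P ξ, ∑ r ∈ sect Q η, thetaVal V q r) ≤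
      ∑ ξ : Pd n, ∑ η : Pd n, μ ξ η * ∑ q : Pd k, ind P (glue ξ q) * ind Q (glue η q) * d q := by
    refine Finset.sum_le_sum fun ξ _ => Finset.sum_le_sum fun η _ => ?_
    rw [← sum_mem_sect_inter_eq d P Q ξ η]
    exact mul_le_mul_of_nonneg_left (hN (sect P ξ) (sect Q η) (isUpperSet_sect hP ξ) (isUpperSet_sect hQ η)) (hμ ξ η)
  refine le_trans h2 ?_
  -- step 1: (H) on the fibres, weighted by d ≥ 0
  rw [sum_mem_inter_dprime_eq d P Q]
  have e : (∑ ξ : Pd n, ∑ η : Pd n, μ ξ η * ∑ q : Pd k, ind P (glue ξ q) * ind Q (glue η q) * d q) =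
      ∑ q : Pd k, d q * ∑ ξ : Pd n, ∑ η : Pd n, μ ξ η * (ind (fibre P q) ξ * ind (fibre Q q) η) := by
    have e1 : (∑ ξ : Pd n, ∑ η : Pd n, μ ξ η * ∑ q : Pd k, ind P (glue ξ q) * ind Q (glue η q) * d q) =
        ∑ ξ : Pd n, ∑ η : Pd n, ∑ q : Pd k, d q * (μ ξ η * (ind (fibre P q) ξ * ind (fibre Q q) η)) := by
      refine Finset.sum_congr rfl fun ξ _ => Finset.sum_congr rfl fun η _ => ?_
      rw [Finset.mul_sum]
      refine Finset.sum_congr rfl fun q _ => ?_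
      rw [ind_fibre, ind_fibre]; ring
    rw [e1, sum_comm3]
    refine Finset.sum_congr rfl fun q _ => ?_
    rw [Finset.mul_sum]
    refine Finset.sum_congr rfl fun ξ _ => ?_
    rw [Finset.mul_sum]
  rw [e]
  refine Finset.sum_le_sum fun q _ => ?_
  have hq := hH (fibre P q) (fibre Q q) (isUpperSet_fibre hP q) (isUpperSet_fibre hQ q)
  have e2 : (∑ ξ : Pd n, ind S ξ * ind (fibre P q) ξ * ind (fibre Q q) ξ) = ∑ ξ : Pd n, ind S ξ * ind P (glue ξ q) * ind Q (glue ξ q) := by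
    refine Finset.sum_congr rfl fun ξ _ => ?_
    rw [ind_fibre, ind_fibre]
  rw [e2] at hq
  exact mul_le_mul_of_nonneg_left hq (hd q)

/-- **COROLLARY (the block product is good in every dimension, given (T) for `d'` and a routing of `S`).**  Under the hypotheses of
`diagCert_blockAnd_N_of_routing` plus (T) for `d'` on `A` (supplied by `…DiagCertBlockAndT.diagCert_blockAnd_T` for every up-set `S` and every `d` with (T) for `V`):
`0 ≤ sStarD ([3]^m × A) B C` for all up-sets `B, C ⊆ [3]^{m+(n+k)}` and every `m`. [this work] -/
theorem sStarD_blockAnd_cylSet_nonneg_of_routing {m : ℕ} (hA : ∀ ξ z, glue ξ z ∈ A ↔ (ξ ∈ S ∧ z ∈ V)) (d : Pd k → ℤ) (hd : ∀ q, 0 ≤ d q)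
    (hN : ∀ X X' : Finset (Pd k), IsUpperSet (X : Set (Pd k)) → IsUpperSet (X' : Set (Pd k)) →
      (∑ q ∈ X, ∑ r ∈ X', thetaVal V q r) ≤ ∑ q ∈ X ∩ X', d q)
    (μ : Pd n → Pd n → ℤ) (hμ : ∀ ξ η, 0 ≤ μ ξ η)
    (hH : ∀ X X' : Finset (Pd n), IsUpperSet (X : Set (Pd n)) → IsUpperSet (X' : Set (Pd n)) →
      (∑ ξ : Pd n, ∑ η : Pd n, μ ξ η * (ind X ξ * ind X' η)) ≤ (2:ℤ) ^ n * ∑ ξ : Pd n, ind S ξ * ind X ξ * ind X' ξ)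
    (hR : ∀ P Q : Finset (Pd (n + k)), IsUpperSet (P : Set (Pd (n + k))) → IsUpperSet (Q : Set (Pd (n + k))) →
      (∑ x ∈ P, ∑ y ∈ Q, thetaVal A x y) ≤ ∑ ξ : Pd n, ∑ η : Pd n, μ ξ η * ∑ q ∈ sect P ξ, ∑ r ∈ sect Q η, thetaVal V q r)
    (hT' : ∀ W : Finset (Pd (n + k)), IsUpperSet (W : Set (Pd (n + k))) →
      (∑ x ∈ W, (2:ℤ) ^ n * ind S (freeOf x) * d (cellOf x)) ≤ ∑ x ∈ W, lamU A x)
    {B C : Finset (Pd (m + (n + k)))} (hB : IsUpperSet (B : Set (Pd (m + (n + k))))) (hC : IsUpperSet (C : Set (Pd (m + (n + k))))) :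
    0 ≤ sStarD (cylSet A : Finset (Pd (m + (n + k)))) B C := by
  refine sStarD_cylSet_nonneg_of_diagCert A (fun x => (2:ℤ) ^ n * ind S (freeOf x) * d (cellOf x)) ?_ hT' ?_ hB hC
  · intro x
    exact mul_nonneg (mul_nonneg (pow_nonneg (by norm_num) n) (ind_nonneg' S (freeOf x))) (hd (cellOf x))
  · intro P Q hP hQ
    exact diagCert_blockAnd_N_of_routing hA d hd hN μ hμ hH hR hP hQ

end Summit.CriticalPhenomena.PercolationContinuityZ3.Theorems.SahiGridPattern
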